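import Summits.ResolutionOfSingularities.ResolutionOfSingularities.Theorems.FrobeniusLadderFInjectiveMacaulayficationNonFullLoopFloorThree
import Summits.ResolutionOfSingularities.ResolutionOfSingularities.Theorems.FrobeniusLadderFInjectiveMacaulayficationKLocCellKitOff
import Summits.ResolutionOfSingularities.ResolutionOfSingularities.Theorems.FrobeniusLadderFInjectiveMacaulayficationKLocCellOff
import Summits.ResolutionOfSingularities.ResolutionOfSingularities.Theorems.FrobeniusLadderFInjectiveMacaulayficationClauseOfMaximal
import Summits.ResolutionOfSingularities.ResolutionOfSingularities.Theorems.FrobeniusLadderFInjectiveMacaulayficationPConeFedderData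
import Literature.AlgebraicGeometry.Resolution.AffineBlowupCartier
import Summits.ResolutionOfSingularities.ResolutionOfSingularities.Theorems.FrobeniusLadderFInjectiveMacaulayficationNonFullLoopFloorOneLocus
import HarnessLib

/-!
# NEG-N, FLOOR 3: ★★★ THE TWO-SIDED LOCUS LEMMA — a point of `U₃ = Spec k[x,y,u,t,z]/(g₃)`, `g₃ = z² + x³z + y³+u³+t³`, is NON-FULL **iff**
# it is the origin (`char k = 2`); and the chart open immersion `U₄ ⟶ Bl_𝔪 U₃`
# (crux `FInjectiveMacaulayfication` stmt-ResolutionOfSingularities-15315, chain w45a; res-L1-w45a-plan-1 g19 RULINGS R19.21 «NEG-N» / R19.22 (NEG-3 → stub-1);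
# sequel of this seat's ✓ p644128 `…NonFullLoopFloorThree` (chart identity, primality, `exists_chartEquiv_x`, «⊇» half `not_fullCl_of_origin_le`); floor table
# res-L1-w45a-tri-2 g16 l.81567 (`k = 3: S₃ = 𝔪, Bl 𝔪 @x`) / FIRST-STEP PASS l.81588 (`fl 3: D(x) ε = xz, g = x · D(y) ε = y, g = y · D(u), D(t) likewise ·
# D(z) ε = 1, g = z`); seat res-L1-w45a-stub-1 g12; off-cell template = res-L1-w45a-stub-3's `LoopGermLCureAll.offCentre_clause` ✓ p643746)

[OURS · L1 W4.5a] Support file (`--supports stmt-ResolutionOfSingularities-15315 --as helper`); replaces the role of NO printed item; NOT a statement of any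
manuscript; def-free; UNCONDITIONAL; `CharP k 2` where marked. AI-written (AI review is weaker than expert review).

`X 0 = x`, `X 1 = y`, `X 2 = u`, `X 3 = t`, `X 4 = z`; `A₃ = k[X]/(g₃)` (the `U₁`/`A₁` of p644128's docstrings = floor 3), `𝔪 = (x̄, ȳ, ū, t̄, z̄) = Ideal.span (Set.range fun j => mk (X j))`.
* §1 ★ `offCentre_clause` — `A₃` carries the CM + Frobenius-closed clause at every MAXIMAL ideal other than `𝔪` (i.e. missing some `x̄ⱼ`): the p-basis split
  `g₃ = 1·z² + (xz)·x² + y·y² + u·u² + t·t²` has the five OFF-cells `x² · (xz)`, `y² · y`, `u² · u`, `t² · t`, `z² · 1` — ONE `decide +kernel`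
  over `KLocCellKit.checkKsOff` and res-L1-w45a-stub-5's `KLocCellOff.honQuot_of_kLocCells_off`; `g₃_eq_evalL`, `not_X_dvd_g₃` (`evalL_X` from this seat's ✓ p646599 `…NonFullLoopFloorOneLocus`);
* §2 ★★ `fullCl_localization_of_not_origin_le` / `fullCl_stalk_of_not_origin_le` — FULL at EVERY point `w ≠` origin (closed or not; Jacobson step +
  `ClauseOfMaximal.fiClause_atPrime_of_le` + `Spec.stalkIso`); ★★★ `not_fullCl_stalk_iff_origin_le : ∀ w, ¬ FullCl 2 𝒪_{U₃,w} ↔ 𝔪 ≤ w` (+ localization twin,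
  + the `'' ↑Finset.univ` spelling of res-L1-w45a-lead-1's frame): the non-FULL locus of floor 3 IS the closed point `V(𝔪)` = the N-centre `S₃`;
* §3 ★ `exists_chart_isOpenImmersion` — the scheme-level link `U₄ = Spec k[X]/(g₄) ⟶ Bl_𝔪 U₃`, an OPEN IMMERSION (`NonFullLoopFloorThree.exists_chartEquiv_x` +
  Literature `affineBlowup.chartι`; lead-1's `NonFullLoopFrame.exists_chart_isOpenImmersion` pattern).
[cite: Fedder1983, Prop. 1.7 and Thm. 1.12] [cite: StacksProject, Tag 0804]
-/

-- single-problem summit: the doubled namespace component is forced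
set_option linter.dupNamespace false

noncomputable section

open AlgebraicGeometry CategoryTheory Literature.AlgebraicGeometry.Resolution TopologicalSpace IsLocalRing MvPolynomial

namespace Summit.ResolutionOfSingularities.ResolutionOfSingularities.Theorems.FInjectiveMacaulayfication.NonFullLoopFloorThree

open Summit.ResolutionOfSingularities.ResolutionOfSingularities.Theorems.FInjectiveMacaulayfication
open SliceableCentre

variable (k : Type) [Field k]

/-! ## §1 `U₃` is F-pure (and CM) off the origin: five OFF-cells -/

/-- `g₃` is the value of its term list. [plumbing] -/
theorem g₃_eq_evalL : (X 4 ^ 2 + X 0 ^ 3 * X 4 + X 1 ^ 3 + X 2 ^ 3 + X 3 ^ 3 : MvPolynomial (Fin 5) k) =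
    KLocCellKit.evalL k [((1 : ℤ), ![0, 0, 0, 0, 2]), ((1 : ℤ), ![3, 0, 0, 0, 1]), ((1 : ℤ), ![0, 3, 0, 0, 0]), ((1 : ℤ), ![0, 0, 3, 0, 0]), ((1 : ℤ), ![0, 0, 0, 3, 0])] := by
  simp only [KLocCellKit.evalL, List.map_cons, List.map_nil, List.sum_cons, List.sum_nil, Int.cast_one, PConeFedderData.monomial_five]
  ring

/-- No variable divides `g₃` (`g₃(e_z) = 1`; `g₃(1,1,0,0,0) = 1`). [certificate] -/
theorem not_X_dvd_g₃ (g₃ : MvPolynomial (Fin 5) k) (hg₃ : g₃ = X 4 ^ 2 + X 0 ^ 3 * X 4 + X 1 ^ 3 + X 2 ^ 3 + X 3 ^ 3)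
    (i : Fin 5) : ¬ ((X i : MvPolynomial (Fin 5) k) ∣ g₃) := by
  rintro ⟨c, hc⟩
  by_cases hi : i = 4
  · subst hi
    have := congrArg (MvPolynomial.eval ![(1 : k), 1, 0, 0, 0]) hc
    rw [hg₃] at this
    simp at this
  · have := congrArg (MvPolynomial.eval (Pi.single 4 1 : Fin 5 → k)) hc
    rw [hg₃] at this
    simp [hi] at this

set_option maxHeartbeats 800000 in
-- one kernel `decide` for the five off-cells + the off-cell engine
/-- ★ **`U₃` OFF THE ORIGIN**: `k[X]/(g₃)` satisfies the CM + Frobenius-closed clause at every maximal ideal missing one of `x̄, ȳ, ū, t̄, z̄` (`char k = 2`). The five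
OFF-cells `x² · (xz)`, `y² · y`, `u² · u`, `t² · t`, `z² · 1`: the p-basis split of `g₃` has coefficients `x², y², u², t², z²` on the classes `xz, y, u, t, 1`
— so `h² ∈ (split coefficients)` for `h = x, y, u, t, z` (Fedder: `g₃ ∉ 𝔫^{[2]}` when `h ∉ 𝔫`; tri-2 l.81588 fl 3). NOT claimed at `𝔪` (false there, p644128). [cite: Fedder1983, Prop. 1.7, Thm. 1.12] -/
theorem offCentre_clause [CharP k 2] (g₃ : MvPolynomial (Fin 5) k) (hg₃ : g₃ = X 4 ^ 2 + X 0 ^ 3 * X 4 + X 1 ^ 3 + X 2 ^ 3 + X 3 ^ 3)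
    (Q' : Ideal (MvPolynomial (Fin 5) k ⧸ Ideal.span {g₃})) [Q'.IsMaximal] (hQ' : ∃ j : Fin 5, Ideal.Quotient.mk (Ideal.span {g₃}) (X j) ∉ Q') :
    ∀ d : ℕ, ringKrullDim (Localization.AtPrime Q') = d → ∀ s : Fin d → Localization.AtPrime Q',
      (Ideal.span (Set.range s)).radical.IsMaximal →
        RingTheory.Sequence.IsWeaklyRegular (Localization.AtPrime Q') (List.ofFn s) ∧
        ∀ y : Localization.AtPrime Q', (∃ n : ℕ, y ^ 2 ^ n ∈ Ideal.span
          ((fun z : Localization.AtPrime Q' => z ^ 2 ^ n) '' (Ideal.span (Set.range s) : Set (Localization.AtPrime Q')))) → y ∈ Ideal.span (Set.range s) := by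
  classical
  haveI : Fact (Nat.Prime 2) := ⟨Nat.prime_two⟩
  have hL := g₃_eq_evalL k
  have hg0' : g₃ ≠ 0 := (prime_g₃ k g₃ hg₃).ne_zero
  have hX' := not_X_dvd_g₃ k g₃ hg₃
  have hf' : g₃ = KLocCellKit.evalL k [((1 : ℤ), ![0, 0, 0, 0, 2]), ((1 : ℤ), ![3, 0, 0, 0, 1]), ((1 : ℤ), ![0, 3, 0, 0, 0]), ((1 : ℤ), ![0, 0, 3, 0, 0]), ((1 : ℤ), ![0, 0, 0, 3, 0])] :=
    hg₃.trans hL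
  subst hf'
  have hcellsOff := KLocCellKit.offCells_of_check (K := k) 2
    [((1 : ℤ), ![0, 0, 0, 0, 2]), ((1 : ℤ), ![3, 0, 0, 0, 1]), ((1 : ℤ), ![0, 3, 0, 0, 0]), ((1 : ℤ), ![0, 0, 3, 0, 0]), ((1 : ℤ), ![0, 0, 0, 3, 0])]
    [(∅ : Finset (Fin 5))]
    [[((1 : ℤ), (Pi.single 0 1 : Fin 5 → ℕ))], [((1 : ℤ), (Pi.single 1 1 : Fin 5 → ℕ))], [((1 : ℤ), (Pi.single 2 1 : Fin 5 → ℕ))],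
      [((1 : ℤ), (Pi.single 3 1 : Fin 5 → ℕ))], [((1 : ℤ), (Pi.single 4 1 : Fin 5 → ℕ))]]
    [((∅ : Finset (Fin 5)), [(![1, 0, 0, 0, 1], [((1 : ℤ), ![0, 0, 0, 0, 0])])], (fun _ => []), [], [((1 : ℤ), (Pi.single 0 1 : Fin 5 → ℕ))], 2),
      ((∅ : Finset (Fin 5)), [(![0, 1, 0, 0, 0], [((1 : ℤ), ![0, 0, 0, 0, 0])])], (fun _ => []), [], [((1 : ℤ), (Pi.single 1 1 : Fin 5 → ℕ))], 2),
      ((∅ : Finset (Fin 5)), [(![0, 0, 1, 0, 0], [((1 : ℤ), ![0, 0, 0, 0, 0])])], (fun _ => []), [], [((1 : ℤ), (Pi.single 2 1 : Fin 5 → ℕ))], 2),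
      ((∅ : Finset (Fin 5)), [(![0, 0, 0, 1, 0], [((1 : ℤ), ![0, 0, 0, 0, 0])])], (fun _ => []), [], [((1 : ℤ), (Pi.single 3 1 : Fin 5 → ℕ))], 2),
      ((∅ : Finset (Fin 5)), [(![0, 0, 0, 0, 0], [((1 : ℤ), ![0, 0, 0, 0, 0])])], (fun _ => []), [], [((1 : ℤ), (Pi.single 4 1 : Fin 5 → ℕ))], 2)]
    (by decide +kernel) (by decide)
  have H := KLocCellOff.honQuot_of_kLocCells_off 2 k 5 (∅ : Finset (Fin 5)) (1 : Matrix (Fin 5) (Fin 5) ℕ)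
    (KLocCellKit.evalL k [((1 : ℤ), ![0, 0, 0, 0, 2]), ((1 : ℤ), ![3, 0, 0, 0, 1]), ((1 : ℤ), ![0, 3, 0, 0, 0]), ((1 : ℤ), ![0, 0, 3, 0, 0]), ((1 : ℤ), ![0, 0, 0, 3, 0])])
    hg0' hX' [] [(∅ : Finset (Fin 5))]
    (([[((1 : ℤ), (Pi.single 0 1 : Fin 5 → ℕ))], [((1 : ℤ), (Pi.single 1 1 : Fin 5 → ℕ))], [((1 : ℤ), (Pi.single 2 1 : Fin 5 → ℕ))],
      [((1 : ℤ), (Pi.single 3 1 : Fin 5 → ℕ))], [((1 : ℤ), (Pi.single 4 1 : Fin 5 → ℕ))]] : List (List (ℤ × (Fin 5 → ℕ)))).map (KLocCellKit.evalL k))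
    (fun T _ => Or.inr ⟨∅, by simp, Finset.empty_subset T⟩) (by simp) hcellsOff Q' (by simp) ?_
  · exact H.2
  · obtain ⟨j, hjQ⟩ := hQ'
    refine ⟨_, List.mem_map.mpr ⟨[((1 : ℤ), (Pi.single j 1 : Fin 5 → ℕ))], ?_, NonFullLoopFloorOne.evalL_X k j⟩, hjQ⟩
    fin_cases j <;> simp

/-! ## §2 ★★ FULL at every point off the origin (the «⊆» half), and the two-sided locus lemma -/

/-- ★★ **`FullCl 2 ((A₃)_P)` at EVERY prime `P ⊉ 𝔪`** (`char k = 2`): a maximal `Q' ⊇ P` missing the same generator exists (`A₃` is Jacobson), §1 gives the clause at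
`Q'`, and the clause (with `IsDomain`) localizes from `Q'` to `P` (`ClauseOfMaximal.fiClause_atPrime_of_le`). [OURS · certificate; cite: Fedder1983, Thm. 1.12] -/
theorem fullCl_localization_of_not_origin_le [CharP k 2] (g₃ : MvPolynomial (Fin 5) k) (hg₃ : g₃ = X 4 ^ 2 + X 0 ^ 3 * X 4 + X 1 ^ 3 + X 2 ^ 3 + X 3 ^ 3)
    (P : Ideal (MvPolynomial (Fin 5) k ⧸ Ideal.span {g₃})) [P.IsPrime]
    (hP : ¬ Ideal.span (Set.range fun j : Fin 5 => Ideal.Quotient.mk (Ideal.span {g₃}) (X j)) ≤ P) :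
    FullCl 2 (Localization.AtPrime P) := by
  haveI : Fact (Nat.Prime 2) := ⟨Nat.prime_two⟩
  haveI : (Ideal.span {g₃}).IsPrime := (Ideal.span_singleton_prime (prime_g₃ k g₃ hg₃).ne_zero).mpr (prime_g₃ k g₃ hg₃)
  haveI : IsDomain (MvPolynomial (Fin 5) k ⧸ Ideal.span {g₃}) := Ideal.Quotient.isDomain _
  haveI : CharP (MvPolynomial (Fin 5) k ⧸ Ideal.span {g₃}) 2 := charP_of_injective_algebraMap (algebraMap k _).injective 2
  -- a generator outside `P`
  have hex : ∃ j : Fin 5, Ideal.Quotient.mk (Ideal.span {g₃}) (X j) ∉ P := by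
    by_contra hcon
    push Not at hcon
    exact hP (Ideal.span_le.mpr (by rintro _ ⟨j, rfl⟩; exact hcon j))
  obtain ⟨j, hjP⟩ := hex
  -- Jacobson: a maximal ideal `Q' ⊇ P` missing the same generator
  have hJ : P.jacobson = P := IsJacobsonRing.out inferInstance (Ideal.IsPrime.isRadical ‹_›)
  have hexQ : ∃ Q' : Ideal (MvPolynomial (Fin 5) k ⧸ Ideal.span {g₃}), Q'.IsMaximal ∧ P ≤ Q' ∧ Ideal.Quotient.mk (Ideal.span {g₃}) (X j) ∉ Q' := by
    by_contra hcon
    push Not at hcon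
    apply hjP
    rw [← hJ, Ideal.jacobson, Ideal.mem_sInf]
    rintro Q ⟨hPQ, hQ⟩
    exact hcon Q hQ hPQ
  obtain ⟨Q', hQ'max, hPQ', hjQ'⟩ := hexQ
  exact ClauseOfMaximal.fiClause_atPrime_of_le 2 hPQ' ⟨inferInstance, offCentre_clause k g₃ hg₃ Q' ⟨j, hjQ'⟩⟩

/-- ★★ **THE «⊆» HALF OF THE FLOOR-3 LOCUS LEMMA** (stalk form): every point `w` of `U₃` other than the origin (`¬ 𝔪 ≤ w`) is FULL (`char k = 2`). [OURS · certificate] -/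
theorem fullCl_stalk_of_not_origin_le [CharP k 2] (g₃ : MvPolynomial (Fin 5) k) (hg₃ : g₃ = X 4 ^ 2 + X 0 ^ 3 * X 4 + X 1 ^ 3 + X 2 ^ 3 + X 3 ^ 3)
    (w : Spec (.of (MvPolynomial (Fin 5) k ⧸ Ideal.span {g₃})))
    (hw : ¬ Ideal.span (Set.range fun j : Fin 5 => Ideal.Quotient.mk (Ideal.span {g₃}) (X j)) ≤ w.asIdeal) :
    FullCl 2 ((Spec (.of (MvPolynomial (Fin 5) k ⧸ Ideal.span {g₃}))).presheaf.stalk w) :=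
  WFixAtNonClosedDimTwo.fullCl_of_ringEquiv 2 (Spec.stalkIso (.of _) w).commRingCatIsoToRingEquiv.symm
    (fullCl_localization_of_not_origin_le k g₃ hg₃ w.asIdeal hw)

/-- ★★★ **THE FLOOR-3 LOCUS LEMMA, BOTH SIDES**: for `U₃ = Spec k[X]/(g₃)`, `g₃ = z² + x³z + y³+u³+t³`, `char k = 2`, a point `w` is NON-FULL **iff** `𝔪 ≤ w`
(iff `w` is the origin). So the non-FULL locus of floor 3 is the reduced closed point — the N-centre `S₃ = 𝔪` of tri-2's table, whose `x`-chart is `U₄`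
(`NonFullLoopFloorThree.exists_chartEquiv_x`, §3). [OURS · certificate; cite: Fedder1983, Prop. 1.7 and Thm. 1.12] -/
theorem not_fullCl_stalk_iff_origin_le [CharP k 2] (g₃ : MvPolynomial (Fin 5) k) (hg₃ : g₃ = X 4 ^ 2 + X 0 ^ 3 * X 4 + X 1 ^ 3 + X 2 ^ 3 + X 3 ^ 3) :
    ∀ w : Spec (.of (MvPolynomial (Fin 5) k ⧸ Ideal.span {g₃})),
      ¬ FullCl 2 ((Spec (.of (MvPolynomial (Fin 5) k ⧸ Ideal.span {g₃}))).presheaf.stalk w) ↔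
        Ideal.span (Set.range fun j : Fin 5 => Ideal.Quotient.mk (Ideal.span {g₃}) (X j)) ≤ w.asIdeal :=
  fun w => ⟨fun h => by_contra fun hw => h (fullCl_stalk_of_not_origin_le k g₃ hg₃ w hw), fun hw => not_fullCl_of_origin_le k g₃ hg₃ w hw⟩

/-- The same in res-L1-w45a-lead-1's `Finset`-image spelling of centres (`Λ = Finset.univ`): `¬ FullCl 2 𝒪_{U₃,w} ↔ (x̄ⱼ : j ∈ univ) ≤ w`. [OURS · certificate] -/
theorem not_fullCl_stalk_iff_centre_le [CharP k 2] (g₃ : MvPolynomial (Fin 5) k) (hg₃ : g₃ = X 4 ^ 2 + X 0 ^ 3 * X 4 + X 1 ^ 3 + X 2 ^ 3 + X 3 ^ 3) :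
    ∀ w : Spec (.of (MvPolynomial (Fin 5) k ⧸ Ideal.span {g₃})),
      ¬ FullCl 2 ((Spec (.of (MvPolynomial (Fin 5) k ⧸ Ideal.span {g₃}))).presheaf.stalk w) ↔
        Ideal.span ((fun j : Fin 5 => Ideal.Quotient.mk (Ideal.span {g₃}) (X j)) '' ((Finset.univ : Finset (Fin 5)) : Set (Fin 5))) ≤ w.asIdeal := by
  intro w
  rw [Finset.coe_univ, Set.image_univ]
  exact not_fullCl_stalk_iff_origin_le k g₃ hg₃ w

/-- Localization form: `¬ FullCl 2 ((A₃)_P) ↔ 𝔪 ≤ P` for every prime `P` of `A₃`. [OURS · certificate] -/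
theorem not_fullCl_localization_iff_origin_le [CharP k 2] (g₃ : MvPolynomial (Fin 5) k) (hg₃ : g₃ = X 4 ^ 2 + X 0 ^ 3 * X 4 + X 1 ^ 3 + X 2 ^ 3 + X 3 ^ 3)
    (P : Ideal (MvPolynomial (Fin 5) k ⧸ Ideal.span {g₃})) [P.IsPrime] :
    ¬ FullCl 2 (Localization.AtPrime P) ↔ Ideal.span (Set.range fun j : Fin 5 => Ideal.Quotient.mk (Ideal.span {g₃}) (X j)) ≤ P :=
  ⟨fun h => by_contra fun hP => h (fullCl_localization_of_not_origin_le k g₃ hg₃ P hP), fun hP => origin_not_fullCl_localization k g₃ hg₃ P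
    ((isMaximal_origin k g₃ hg₃).eq_of_le Ideal.IsPrime.ne_top' hP).symm⟩

/-! ## §3 ★ The chart open immersion `U₄ ⟶ Bl_𝔪 U₃` -/

/-- ★ **THE FLOOR-3 → FLOOR-4 LINK AT SCHEME LEVEL**: `U₄ = Spec k[X]/(g₄)` is an OPEN SUBSCHEME of `Bl_𝔪 U₃` — the composite of the iso `Spec` of
`NonFullLoopFloorThree.exists_chartEquiv_x` with the chart `affineBlowup.chartι` at `x̄`. [folklore assembly; cite: StacksProject, Tag 0804] -/
theorem exists_chart_isOpenImmersion [CharP k 2] (g₃ : MvPolynomial (Fin 5) k) (hg₃ : g₃ = X 4 ^ 2 + X 0 ^ 3 * X 4 + X 1 ^ 3 + X 2 ^ 3 + X 3 ^ 3)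
    (g₄ : MvPolynomial (Fin 5) k) (hg₄ : g₄ = X 4 ^ 2 + X 0 ^ 2 * X 4 + X 0 * X 1 ^ 3 + X 0 * X 2 ^ 3 + X 0 * X 3 ^ 3) :
    ∃ j : Spec (.of (MvPolynomial (Fin 5) k ⧸ Ideal.span {g₄})) ⟶
        affineBlowup (Ideal.span (Set.range fun j : Fin 5 => Ideal.Quotient.mk (Ideal.span {g₃}) (X j))),
      IsOpenImmersion j := by
  obtain ⟨e, -⟩ := exists_chartEquiv_x k g₃ hg₃ g₄ hg₄
  exact ⟨Spec.map e.symm.toCommRingCatIso.hom ≫ affineBlowup.chartι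
      (I := Ideal.span (Set.range fun j : Fin 5 => Ideal.Quotient.mk (Ideal.span {g₃}) (X j)))
      (Ideal.Quotient.mk (Ideal.span {g₃}) (X 0)) (Ideal.subset_span (Set.mem_range_self 0)), inferInstance⟩

end Summit.ResolutionOfSingularities.ResolutionOfSingularities.Theorems.FInjectiveMacaulayfication.NonFullLoopFloorThree

end
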